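import Literature.NumberTheory.Sieve.FordAsymptoticSieveCombinatorics
import Mathlib.Algebra.Polynomial.AlgebraMap
import Mathlib.RingTheory.PowerSeries.Basic
import Mathlib.Algebra.Algebra.Basic
import Mathlib.LinearAlgebra.Span.Basic
import Mathlib.Algebra.Algebra.Operations
import HarnessLib

/-!
# Ford's counterexamples to a fixed-level asymptotic sieve: the exponential formula in an algebra

Topic `Literature/NumberTheory/Sieve`, companion of `FordAsymptoticSieve.lean` (the named fact
`Literature.NumberTheory.Sieve.Ford2004_localConstruction`) and of
`FordAsymptoticSieveCombinatorics.lean` (the numerical identities `Ford2004.gamma_eq`,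
`Ford2004.W_eq`). Source: K. Ford, *On Bombieri's asymptotic sieve*, Trans. Amer. Math. Soc.
**357** (2005) 1663–1674 (arXiv math/0401215) [Ford2004], §3, (3.8)–(3.10) and (3.12)–(3.14).

The identities (3.9)–(3.10) (`γ_m = 0`, i.e. `exp(log(1+X)) = 1 + X`) and (3.13)–(3.14) (the
numbers `W(M,N)`, i.e. `exp(log(1+XY) − log(1+X)) = (1+XY)/(1+X)`) are used in the proof of
[Ford2004] Theorem 3 to collapse a sum over ordered factorisations `n = p_1 ⋯ p_r` with weights
`∏ c_{a_i}`, `c_a = (−1)^{a+1}/a`, into one or two terms. In the formalisation the prime sums are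
compared with elements of a commutative algebra `U` (the unitised convolution algebra of
`FordAsymptoticSieveConvolution.lean`), and what is needed is the same identity INSIDE `U`. This
file proves it once, abstractly, for any commutative algebra over a field of characteristic zero
(everything PROVED; the only definitions are the explicit polynomials involved):

* `Ford2004.expCoeff_eq` — with `W = ∑_{a=1}^{M} c_a (Ψ^a − Φ^a) T^a ∈ U[T]` and
  `e_m = ∑_{r ≤ m} (1/r!) [T^m] W^r`: `e_0 = 1`, `e_m = (−1)^{m−1} (Ψ − Φ) Φ^{m−1}` for
  `1 ≤ m ≤ M` (the truncation of `exp(log(1+ΨT) − log(1+ΦT)) = (1+ΨT)(1+ΦT)⁻¹`), by the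
  recursion `Ford2004.expFormula_recursion` (`E' = W'E`) and a geometric sum;
* `Ford2004.apply_sum_pow_logCoeff_eq` — consequently, for every linear functional `ℓ` killing
  the monomials `Ψ^i Φ^j` with `i + j > M` ("junk" of degree `> M`, which in the application
  vanishes for support reasons),
  `ℓ(∑_{r=1}^{M} (1/r!) (∑_{a=1}^{M} c_a (Ψ^a − Φ^a))^r) = ∑_{m=1}^{M} ℓ((−1)^{m−1}(Ψ − Φ)Φ^{m−1})`;
  with `Φ = 0` this is (3.9)–(3.10), in general it is (3.12)–(3.14) (all `N` at once);
* the degree bookkeeping `Ford2004.gradedPiece` (`D_m = span{Ψ^iΦ^j : i+j = m}`),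
  `Ford2004.Graded`, used to show that the terms of degree `> M` are junk.

## References

* K. Ford, *On Bombieri's asymptotic sieve*, Trans. AMS 357 (2005), 1663–1674, §3 [Ford2004].
-/

namespace Literature.NumberTheory.Sieve.Ford2004

open Finset PowerSeries

section ExpLog

variable {𝕜 : Type*} [Field 𝕜] {U : Type*} [CommRing U] [Algebra 𝕜 U]

/-- Ford's coefficients `c_a = (−1)^{a+1}/a` (`a ≥ 1`), the Taylor coefficients of `log(1 + X)`;
`c_0 = 0`. [cite: Ford2004, §3 (3.8)–(3.9)] -/
def logCoeff (𝕜 : Type*) [Field 𝕜] (a : ℕ) : 𝕜 := (-1) ^ (a + 1) / a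

/-- `logCoeff_zero`: auxiliary (unfolding / closure / size lemma). [folklore] -/
@[simp] theorem logCoeff_zero : logCoeff 𝕜 0 = 0 := by simp [logCoeff]

/-- `succ_mul_logCoeff_succ`: auxiliary (unfolding / closure / size lemma). [folklore] -/
theorem succ_mul_logCoeff_succ [CharZero 𝕜] (j : ℕ) : ((j : 𝕜) + 1) * logCoeff 𝕜 (j + 1) = (-1) ^ j := by
  rw [logCoeff, pow_succ, pow_succ]
  have : (j : 𝕜) + 1 ≠ 0 := by exact_mod_cast Nat.succ_ne_zero j
  field_simp
  push_cast
  ring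

/-- The truncated two-variable logarithm `W = ∑_{a=1}^{M} c_a (Ψ^a − Φ^a) T^a ∈ U[T]`
("`log(1 + ΨT) − log(1 + ΦT)` mod `T^{M+1}`"). [cite: Ford2004, §3 (3.13)–(3.14)] -/
noncomputable def logPoly (M : ℕ) (Ψ Φ : U) : Polynomial U :=
  ∑ a ∈ Icc 1 M, Polynomial.C (logCoeff 𝕜 a • (Ψ ^ a - Φ ^ a)) * Polynomial.X ^ a

/-- `coeff_logPoly`: auxiliary (unfolding / closure / size lemma). [folklore] -/
theorem coeff_logPoly (M : ℕ) (Ψ Φ : U) (d : ℕ) :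
    (logPoly (𝕜 := 𝕜) M Ψ Φ).coeff d = if d ∈ Icc 1 M then logCoeff 𝕜 d • (Ψ ^ d - Φ ^ d) else 0 := by
  rw [logPoly, Polynomial.finsetSum_coeff]
  simp_rw [Polynomial.coeff_C_mul_X_pow]
  rw [Finset.sum_ite_eq (Icc 1 M) d]

/-- `coeff_logPoly_of_mem`: auxiliary (unfolding / closure / size lemma). [folklore] -/
theorem coeff_logPoly_of_mem {M : ℕ} (Ψ Φ : U) {d : ℕ} (hd : d ∈ Icc 1 M) :
    (logPoly (𝕜 := 𝕜) M Ψ Φ).coeff d = logCoeff 𝕜 d • (Ψ ^ d - Φ ^ d) := by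
  rw [coeff_logPoly, if_pos hd]

/-- `coeff_logPoly_zero`: auxiliary (unfolding / closure / size lemma). [folklore] -/
theorem coeff_logPoly_zero (M : ℕ) (Ψ Φ : U) : (logPoly (𝕜 := 𝕜) M Ψ Φ).coeff 0 = 0 := by
  rw [coeff_logPoly, if_neg (by simp)]

/-- The truncated exponential coefficients `e_m = ∑_{r ≤ m} (1/r!) [T^m] W^r`. [folklore] -/
noncomputable def expCoeff (M : ℕ) (Ψ Φ : U) (m : ℕ) : U :=
  ∑ r ∈ range (m + 1), algebraMap 𝕜 U ((r.factorial : 𝕜)⁻¹) *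
    PowerSeries.coeff m (((logPoly (𝕜 := 𝕜) M Ψ Φ : Polynomial U) : PowerSeries U) ^ r)

/-- Geometric-sum identity over the antidiagonal: `(x − y) ∑_{i+j=n} y^i x^j = x^{n+1} − y^{n+1}`.
[folklore] -/
theorem sub_mul_sum_antidiagonal_pow (x y : U) (n : ℕ) :
    (x - y) * ∑ p ∈ antidiagonal n, y ^ p.1 * x ^ p.2 = x ^ (n + 1) - y ^ (n + 1) := by
  induction n with
  | zero => simp
  | succ n ih =>
    rw [Finset.Nat.sum_antidiagonal_succ]
    have : ∑ p ∈ antidiagonal n, y ^ (p.1 + 1) * x ^ p.2 = y * ∑ p ∈ antidiagonal n, y ^ p.1 * x ^ p.2 := by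
      rw [Finset.mul_sum]
      refine Finset.sum_congr rfl fun p _ => ?_
      rw [pow_succ]; ring
    rw [this]
    dsimp only
    linear_combination y * ih

/-- **The exponential formula for `log(1+ΨT) − log(1+ΦT)`** (the algebra behind [Ford2004]
(3.9)–(3.10) and (3.13)–(3.14), in any commutative algebra): the coefficients
`e_m = ∑_{r ≤ m} (1/r!) [T^m] W^r` of `exp W`, `W = ∑_{a ≤ M} c_a (Ψ^a − Φ^a) T^a`, are
`e_0 = 1` and `e_m = (−1)^{m−1} (Ψ − Φ) Φ^{m−1}` for `1 ≤ m ≤ M` — i.e.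
`exp(W) ≡ (1 + ΨT)(1 + ΦT)⁻¹ (mod T^{M+1})`. Proof: the recursion `(m+1) e_{m+1} =
∑_{i+j=m} e_i (j+1) [T^{j+1}] W` (`Ford2004.expFormula_recursion`, `E' = W'E`) with
`(j+1) c_{j+1} = (−1)^j`, and a geometric sum. [cite: Ford2004, §3 (3.10), (3.14)] -/
theorem expCoeff_eq [CharZero 𝕜] {M : ℕ} (Ψ Φ : U) :
    expCoeff (𝕜 := 𝕜) M Ψ Φ 0 = 1 ∧
      ∀ m, 1 ≤ m → m ≤ M →
        expCoeff (𝕜 := 𝕜) M Ψ Φ m = (-1 : U) ^ (m - 1) * ((Ψ - Φ) * Φ ^ (m - 1)) := by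
  set W : PowerSeries U := ((logPoly (𝕜 := 𝕜) M Ψ Φ : Polynomial U) : PowerSeries U) with hWdef
  set e : ℕ → U := expCoeff (𝕜 := 𝕜) M Ψ Φ with hedef
  have hW : constantCoeff W = 0 := by
    rw [← PowerSeries.coeff_zero_eq_constantCoeff_apply, hWdef, Polynomial.coeff_coe,
      coeff_logPoly_zero]
  have hu : ∀ r : ℕ, ((r : U) + 1) * algebraMap 𝕜 U ((((r + 1).factorial : 𝕜))⁻¹) =
      algebraMap 𝕜 U ((r.factorial : 𝕜)⁻¹) := by
    intro r
    have h1 : ((r : U) + 1) = algebraMap 𝕜 U ((r : 𝕜) + 1) := by simp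
    rw [h1, ← map_mul]
    congr 1
    rw [Nat.factorial_succ]
    have hr : (r.factorial : 𝕜) ≠ 0 := by exact_mod_cast r.factorial_ne_zero
    have hr1 : (r : 𝕜) + 1 ≠ 0 := by exact_mod_cast Nat.succ_ne_zero r
    push_cast
    field_simp
  have hrec := expFormula_recursion (u := fun r : ℕ => algebraMap 𝕜 U ((r.factorial : 𝕜)⁻¹)) hW hu
    (e := e) (fun m => rfl)
  -- `(j+1) [T^{j+1}] W = (−1)^j (Ψ^{j+1} − Φ^{j+1})` for `j + 1 ≤ M`
  have hcoef : ∀ j : ℕ, j + 1 ≤ M →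
      ((j : U) + 1) * coeff (j + 1) W = (-1) ^ j * (Ψ ^ (j + 1) - Φ ^ (j + 1)) := by
    intro j hj
    rw [hWdef, Polynomial.coeff_coe, coeff_logPoly_of_mem Ψ Φ (Finset.mem_Icc.mpr ⟨by omega, hj⟩),
      Algebra.smul_def, ← mul_assoc]
    have h1 : ((j : U) + 1) = algebraMap 𝕜 U ((j : 𝕜) + 1) := by simp
    rw [h1, ← map_mul, succ_mul_logCoeff_succ, map_pow, map_neg, map_one]
  have he0 : e 0 = 1 := by
    rw [hedef, expCoeff]
    simp
  refine ⟨he0, ?_⟩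
  -- strong induction on `m`
  intro m
  induction m using Nat.strong_induction_on with
  | _ m ih =>
    intro hm1 hmM
    obtain ⟨n, rfl⟩ : ∃ n, m = n + 1 := ⟨m - 1, by omega⟩
    have hrecn := hrec n
    -- evaluate the right-hand side of the recursion
    have hrhs : ∑ p ∈ antidiagonal n, e p.1 * (((p.2 : U) + 1) * coeff (p.2 + 1) W) =
        ((n : U) + 1) * ((-1) ^ n * ((Ψ - Φ) * Φ ^ n)) := by
      rcases n with _ | n
      · rw [Finset.Nat.antidiagonal_zero, Finset.sum_singleton]
        dsimp only
        rw [he0, one_mul, hcoef 0 hmM]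
        simp
      rw [Finset.Nat.sum_antidiagonal_succ, he0, one_mul, hcoef (n + 1) hmM]
      have h2 : ∀ p ∈ antidiagonal n, e (p.1 + 1) * (((p.2 : U) + 1) * coeff (p.2 + 1) W) =
          (-1) ^ n * ((Ψ - Φ) * (Φ ^ p.1 * (Ψ * Ψ ^ p.2 - Φ * Φ ^ p.2))) := by
        intro p hp
        have hp' : p.1 + p.2 = n := mem_antidiagonal.mp hp
        rw [ih (p.1 + 1) (by omega) (by omega) (by omega), hcoef p.2 (by omega), Nat.add_sub_cancel]
        have : (-1 : U) ^ p.1 * (-1) ^ p.2 = (-1) ^ n := by rw [← pow_add, hp']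
        rw [pow_succ, pow_succ]
        linear_combination ((Ψ - Φ) * (Φ ^ p.1 * (Ψ ^ p.2 * Ψ - Φ ^ p.2 * Φ))) * this
      rw [Finset.sum_congr rfl h2, ← Finset.mul_sum, ← Finset.mul_sum]
      have h3 : ∑ p ∈ antidiagonal n, Φ ^ p.1 * (Ψ * Ψ ^ p.2 - Φ * Φ ^ p.2) =
          Ψ * ∑ p ∈ antidiagonal n, Φ ^ p.1 * Ψ ^ p.2 - ∑ p ∈ antidiagonal n, Φ ^ (n + 1) := by
        rw [Finset.mul_sum, ← Finset.sum_sub_distrib]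
        refine Finset.sum_congr rfl fun p hp => ?_
        have hp' : p.1 + p.2 = n := mem_antidiagonal.mp hp
        have : Φ ^ (n + 1) = Φ ^ p.1 * (Φ * Φ ^ p.2) := by
          rw [← pow_succ', ← pow_add]; congr 1; omega
        rw [this]; ring
      have h4 := sub_mul_sum_antidiagonal_pow Ψ Φ n
      rw [h3, Finset.sum_const, Finset.Nat.card_antidiagonal, nsmul_eq_mul]
      push_cast
      linear_combination ((-1 : U) ^ n * Ψ) * h4
    rw [hrhs] at hrecn
    -- cancel `n + 1`
    have hunit : IsUnit ((n : U) + 1) := by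
      have h1 : ((n : U) + 1) = algebraMap 𝕜 U ((n : 𝕜) + 1) := by simp
      rw [h1]
      exact (IsUnit.mk0 _ (by exact_mod_cast Nat.succ_ne_zero n)).map _
    rw [Nat.add_sub_cancel]
    exact hunit.mul_left_cancel hrecn


/-! ### Degree bookkeeping: the pieces `D_m = span {Ψ^i Φ^j : i + j = m}` -/

/-- The `𝕜`-span of the monomials `Ψ^i Φ^j` of total degree `m`. [folklore] -/
def gradedPiece (𝕜 : Type*) [Field 𝕜] [Algebra 𝕜 U] (Ψ Φ : U) (m : ℕ) : Submodule 𝕜 U :=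
  Submodule.span 𝕜 {x | ∃ i j : ℕ, i + j = m ∧ x = Ψ ^ i * Φ ^ j}

/-- `pow_mul_pow_mem_gradedPiece`: auxiliary (unfolding / closure / size lemma). [folklore] -/
theorem pow_mul_pow_mem_gradedPiece (Ψ Φ : U) {i j m : ℕ} (h : i + j = m) :
    Ψ ^ i * Φ ^ j ∈ gradedPiece 𝕜 Ψ Φ m :=
  Submodule.subset_span ⟨i, j, h, rfl⟩

/-- `mul_mem_gradedPiece`: auxiliary (unfolding / closure / size lemma). [folklore] -/
theorem mul_mem_gradedPiece {Ψ Φ : U} {x y : U} {i j : ℕ} (hx : x ∈ gradedPiece 𝕜 Ψ Φ i)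
    (hy : y ∈ gradedPiece 𝕜 Ψ Φ j) : x * y ∈ gradedPiece 𝕜 Ψ Φ (i + j) := by
  have h1 : x * y ∈ gradedPiece 𝕜 Ψ Φ i * gradedPiece 𝕜 Ψ Φ j := Submodule.mul_mem_mul hx hy
  have h2 : gradedPiece 𝕜 Ψ Φ i * gradedPiece 𝕜 Ψ Φ j ≤ gradedPiece 𝕜 Ψ Φ (i + j) := by
    rw [gradedPiece, gradedPiece, Submodule.span_mul_span, gradedPiece]
    refine Submodule.span_mono ?_
    rintro _ ⟨a, ⟨i₁, j₁, h₁, rfl⟩, b, ⟨i₂, j₂, h₂, rfl⟩, rfl⟩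
    refine ⟨i₁ + i₂, j₁ + j₂, by omega, ?_⟩
    simp only [pow_add]; ring
  exact h2 h1

/-- A polynomial over `U` is *graded* if its `T^m`-coefficient lies in `D_m` for every `m`. [folklore] -/
def Graded (𝕜 : Type*) [Field 𝕜] [Algebra 𝕜 U] (Ψ Φ : U) (p : Polynomial U) : Prop :=
  ∀ m, p.coeff m ∈ gradedPiece 𝕜 Ψ Φ m

/-- `graded_one`: auxiliary (unfolding / closure / size lemma). [folklore] -/
theorem graded_one (Ψ Φ : U) : Graded 𝕜 Ψ Φ 1 := by
  intro m
  rw [Polynomial.coeff_one]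
  split_ifs with h
  · subst h
    simpa using pow_mul_pow_mem_gradedPiece (𝕜 := 𝕜) Ψ Φ (i := 0) (j := 0) rfl
  · exact Submodule.zero_mem _

/-- `Graded.mul`: auxiliary (unfolding / closure / size lemma). [folklore] -/
theorem Graded.mul {Ψ Φ : U} {p q : Polynomial U} (hp : Graded 𝕜 Ψ Φ p) (hq : Graded 𝕜 Ψ Φ q) :
    Graded 𝕜 Ψ Φ (p * q) := by
  intro m
  rw [Polynomial.coeff_mul]
  refine Submodule.sum_mem _ fun x hx => ?_
  have := mul_mem_gradedPiece (hp x.1) (hq x.2)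
  rwa [mem_antidiagonal.mp hx] at this

/-- `Graded.pow`: auxiliary (unfolding / closure / size lemma). [folklore] -/
theorem Graded.pow {Ψ Φ : U} {p : Polynomial U} (hp : Graded 𝕜 Ψ Φ p) (r : ℕ) :
    Graded 𝕜 Ψ Φ (p ^ r) := by
  induction r with
  | zero => simpa using graded_one Ψ Φ
  | succ r ih => rw [pow_succ]; exact ih.mul hp

/-- `graded_logPoly`: auxiliary (unfolding / closure / size lemma). [folklore] -/
theorem graded_logPoly (M : ℕ) (Ψ Φ : U) : Graded 𝕜 Ψ Φ (logPoly (𝕜 := 𝕜) M Ψ Φ) := by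
  intro m
  rw [coeff_logPoly]
  split_ifs
  · refine Submodule.smul_mem _ _ (Submodule.sub_mem _ ?_ ?_)
    · simpa using pow_mul_pow_mem_gradedPiece (𝕜 := 𝕜) Ψ Φ (i := m) (j := 0) rfl
    · simpa using pow_mul_pow_mem_gradedPiece (𝕜 := 𝕜) Ψ Φ (i := 0) (j := m) rfl
  · exact Submodule.zero_mem _

/-- A linear functional vanishing on all monomials of degree `m` vanishes on `D_m`. [folklore] -/
theorem apply_eq_zero_of_mem_gradedPiece {V : Type*} [AddCommGroup V] [Module 𝕜 V]
    (ℓ : U →ₗ[𝕜] V) {Ψ Φ : U} {m : ℕ} (hℓ : ∀ i j : ℕ, i + j = m → ℓ (Ψ ^ i * Φ ^ j) = 0)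
    {x : U} (hx : x ∈ gradedPiece 𝕜 Ψ Φ m) : ℓ x = 0 := by
  rw [← LinearMap.mem_ker]
  revert hx x
  rw [← SetLike.le_def, gradedPiece, Submodule.span_le]
  rintro _ ⟨i, j, h, rfl⟩
  exact LinearMap.mem_ker.mpr (hℓ i j h)

/-! ### From the polynomial ring back to `U`: evaluation at `T = 1` -/

/-- `∑_{r=1}^{M} (1/r!) Q^r`, `Q = ∑_{a ≤ M} c_a (Ψ^a − Φ^a) = W(1)`, splits as the degree `≤ M`
part `∑_{m=1}^{M} e_m` plus graded junk of degrees `> M`. [folklore] -/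
theorem sum_pow_eval_eq [CharZero 𝕜] (M : ℕ) (Ψ Φ : U) :
    ∃ J : ℕ → U, (∀ m, J m ∈ gradedPiece 𝕜 Ψ Φ m) ∧
      ∑ r ∈ Icc 1 M, algebraMap 𝕜 U ((r.factorial : 𝕜)⁻¹) *
          (∑ a ∈ Icc 1 M, logCoeff 𝕜 a • (Ψ ^ a - Φ ^ a)) ^ r =
        ∑ m ∈ Icc 1 M, expCoeff (𝕜 := 𝕜) M Ψ Φ m + ∑ m ∈ Ioc M (M * M), J m := by
  set P : Polynomial U := logPoly (𝕜 := 𝕜) M Ψ Φ with hPdef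
  -- the junk coefficients
  set J : ℕ → U := fun m => ∑ r ∈ Icc 1 M, algebraMap 𝕜 U ((r.factorial : 𝕜)⁻¹) * (P ^ r).coeff m
    with hJdef
  have hJ : ∀ m, J m ∈ gradedPiece 𝕜 Ψ Φ m := by
    intro m
    refine Submodule.sum_mem _ fun r _ => ?_
    rw [Algebra.algebraMap_eq_smul_one, smul_mul_assoc, one_mul]
    exact Submodule.smul_mem _ _ ((graded_logPoly M Ψ Φ).pow r m)
  refine ⟨J, hJ, ?_⟩
  -- `Q = P(1)`
  have hQ : ∑ a ∈ Icc 1 M, logCoeff 𝕜 a • (Ψ ^ a - Φ ^ a) = P.eval 1 := by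
    rw [hPdef, logPoly, Polynomial.eval_finsetSum]
    simp only [Polynomial.eval_mul, Polynomial.eval_C, Polynomial.eval_pow, Polynomial.eval_X, one_pow,
      mul_one]
  -- degree bound
  have hdegP : P.natDegree ≤ M := by
    rw [hPdef, logPoly]
    refine Polynomial.natDegree_sum_le_of_forall_le _ _ fun a ha => ?_
    refine (Polynomial.natDegree_C_mul_X_pow_le _ _).trans (Finset.mem_Icc.mp ha).2
  have hdeg : ∀ r ∈ Icc 1 M, (P ^ r).natDegree < M * M + 1 := by
    intro r hr
    have h1 := Polynomial.natDegree_pow_le (p := P) (n := r)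
    have h2 : r * P.natDegree ≤ M * M := Nat.mul_le_mul (Finset.mem_Icc.mp hr).2 hdegP
    omega
  -- expand `P(1)^r = ∑_m coeff_m (P^r)`
  have hexp : ∀ r ∈ Icc 1 M, (P.eval 1) ^ r = ∑ m ∈ range (M * M + 1), (P ^ r).coeff m := by
    intro r hr
    rw [← Polynomial.eval_pow, Polynomial.eval_eq_sum_range' (hdeg r hr)]
    simp
  rw [hQ, Finset.sum_congr rfl fun r hr => by rw [hexp r hr]]
  simp_rw [Finset.mul_sum]
  rw [Finset.sum_comm]
  -- split the range of `m` as `{0} ∪ Icc 1 M ∪ Ioc M (M*M)`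
  have hsplit : range (M * M + 1) = insert 0 (Icc 1 M ∪ Ioc M (M * M)) := by
    ext m
    simp only [mem_range, mem_insert, mem_union, mem_Icc, mem_Ioc]
    constructor
    · intro h
      by_cases h0 : m = 0
      · exact Or.inl h0
      · right
        by_cases hM : m ≤ M
        · exact Or.inl ⟨by omega, hM⟩
        · exact Or.inr ⟨by omega, by omega⟩
    · rintro (h | ⟨h1, h2⟩ | ⟨h1, h2⟩)
      · omega
      · have : M ≤ M * M := Nat.le_mul_self M
        omega
      · omega
  have hdisj : Disjoint (Icc 1 M) (Ioc M (M * M)) := by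
    rw [Finset.disjoint_left]
    intro m h1 h2
    simp only [mem_Icc, mem_Ioc] at h1 h2
    omega
  rw [hsplit, Finset.sum_insert (by simp), Finset.sum_union hdisj]
  -- the `m = 0` term vanishes: `coeff_0 (P^r) = 0` for `r ≥ 1`
  have hP0 : constantCoeff (P : PowerSeries U) = 0 := by
    rw [← PowerSeries.coeff_zero_eq_constantCoeff_apply, Polynomial.coeff_coe, hPdef, coeff_logPoly_zero]
  have hvan : ∀ r m : ℕ, m < r → (P ^ r).coeff m = 0 := by
    intro r m hmr
    have := coeff_pow_eq_zero_of_lt hP0 hmr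
    rwa [← Polynomial.coe_pow, Polynomial.coeff_coe] at this
  have h0 : ∑ r ∈ Icc 1 M, algebraMap 𝕜 U ((r.factorial : 𝕜)⁻¹) * (P ^ r).coeff 0 = 0 := by
    refine Finset.sum_eq_zero fun r hr => ?_
    rw [hvan r 0 (by linarith [(Finset.mem_Icc.mp hr).1]), mul_zero]
  rw [h0, zero_add]
  congr 1
  -- the degrees `1 ≤ m ≤ M`: `∑_{r=1}^{M} = ∑_{r=0}^{m} = e_m`
  refine Finset.sum_congr rfl fun m hm => ?_
  have hm' := Finset.mem_Icc.mp hm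
  rw [expCoeff, ← hPdef]
  -- rewrite power-series coefficients as polynomial coefficients
  have hps : ∀ r, PowerSeries.coeff m ((P : PowerSeries U) ^ r) = (P ^ r).coeff m := by
    intro r; rw [← Polynomial.coe_pow, Polynomial.coeff_coe]
  simp_rw [hps]
  -- both sides equal the sum over `r ∈ Icc 1 m`
  have hl : ∑ r ∈ Icc 1 M, algebraMap 𝕜 U ((r.factorial : 𝕜)⁻¹) * (P ^ r).coeff m =
      ∑ r ∈ Icc 1 m, algebraMap 𝕜 U ((r.factorial : 𝕜)⁻¹) * (P ^ r).coeff m := by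
    rw [← Finset.sum_subset (Finset.Icc_subset_Icc_right hm'.2)]
    intro r hr hr'
    simp only [mem_Icc, not_and, not_le] at hr hr'
    rw [hvan r m (by omega), mul_zero]
  have hr' : ∑ r ∈ range (m + 1), algebraMap 𝕜 U ((r.factorial : 𝕜)⁻¹) * (P ^ r).coeff m =
      ∑ r ∈ Icc 1 m, algebraMap 𝕜 U ((r.factorial : 𝕜)⁻¹) * (P ^ r).coeff m := by
    rw [Finset.range_eq_Ico, Finset.sum_eq_sum_Ico_succ_bot (by omega : 0 < m + 1), pow_zero,
      Polynomial.coeff_one, if_neg (by omega), mul_zero, zero_add, Finset.Ico_add_one_right_eq_Icc]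
  rw [hl, hr']

/-- **Main algebraic identity** (consumed by the analytic part of [Ford2004] Theorem 3): for any
`𝕜`-linear functional `ℓ` killing all monomials `Ψ^i Φ^j` of total degree `> M`,
`ℓ(∑_{r=1}^{M} (1/r!) (∑_{a=1}^{M} c_a (Ψ^a − Φ^a))^r) = ∑_{m=1}^{M} ℓ((−1)^{m−1} (Ψ − Φ) Φ^{m−1})`.
With `Φ = 0` this is `exp(log(1 + Ψ)) = 1 + Ψ` ((3.9)–(3.10)); in general it encodes the numbers
`W(M, N)` of (3.13)–(3.14). [cite: Ford2004, §3 (3.10), (3.14)] -/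
theorem apply_sum_pow_logCoeff_eq [CharZero 𝕜] {V : Type*} [AddCommGroup V] [Module 𝕜 V]
    (M : ℕ) (Ψ Φ : U) (ℓ : U →ₗ[𝕜] V) (hℓ : ∀ i j : ℕ, M < i + j → ℓ (Ψ ^ i * Φ ^ j) = 0) :
    ℓ (∑ r ∈ Icc 1 M, algebraMap 𝕜 U ((r.factorial : 𝕜)⁻¹) *
        (∑ a ∈ Icc 1 M, logCoeff 𝕜 a • (Ψ ^ a - Φ ^ a)) ^ r) =
      ∑ m ∈ Icc 1 M, ℓ ((-1 : U) ^ (m - 1) * ((Ψ - Φ) * Φ ^ (m - 1))) := by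
  obtain ⟨J, hJ, hsum⟩ := sum_pow_eval_eq (𝕜 := 𝕜) M Ψ Φ
  rw [hsum, map_add, map_sum, map_sum]
  have hjunk : ∑ m ∈ Ioc M (M * M), ℓ (J m) = 0 := by
    refine Finset.sum_eq_zero fun m hm => ?_
    exact apply_eq_zero_of_mem_gradedPiece ℓ
      (fun i j hij => hℓ i j (by rw [hij]; exact (Finset.mem_Ioc.mp hm).1)) (hJ m)
  rw [hjunk, add_zero]
  refine Finset.sum_congr rfl fun m hm => ?_
  have hm' := Finset.mem_Icc.mp hm
  rw [(expCoeff_eq (𝕜 := 𝕜) Ψ Φ).2 m hm'.1 hm'.2]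

end ExpLog

end Literature.NumberTheory.Sieve.Ford2004
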